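import Mathlib
import Summits.ValiantsHypothesis.ValiantsHypothesis.Theorems.LacunarySymmetroidMatrixDescartesDefiniteMomentsZonesExact

/-!
# `MatrixDescartes` (stmt-ValiantsHypothesis-18050) — INERTIA KIT, III: THE INERTIA-WALK CERTIFICATE — the total variation of
# the negative index along any chain of non-singular test scales bounds from below the number of roots of `det F` between
# the end scales COUNTED WITH MULTIPLICITY (every real-symmetric lacunary pencil, every format)

HONEST FRAMING.  Cell `pub-symmetroid`, seat `val-sym-mdr-p2` (gen 16); helper file `--supports` the crux
`Theses.LacunarySymmetroid.MatrixDescartes`, NO closure claim.  A census-facing INSTRUMENT (lower bounds for root counts with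
multiplicity from exact inertia data at finitely many scales — inertias are certifiable by rational congruence
diagonalisations, tree `Literature.Analysis.Matrix.SylvesterInertiaCertificate.card_eigenvalues_lt_eq_card_neg`), valid at
every format; it sees clustered and even-multiplicity crossings that determinant SIGN changes miss (a jump of the index by `k`
between two test scales certifies `k` roots with multiplicity in between, located or not).  Nothing here bears on the crux in
its window, on `stub_twoSided`, on `DoorA26`/`DoorA34`, registers, or `VP ≠ VNP`.

THEOREM (`card_roots_ge_sum_dist_negIndex`).  `F(X) = ∑ₖ X^{dₖ} Sₖ` real symmetric letters, `det F ≢ 0`, test scales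
`x₀ < x₁ < ⋯ < x_N` with every `F(xᵢ)` non-singular.  Then
`∑_{i<N} |ν(F(xᵢ₊₁)) − ν(F(xᵢ))| ≤ #{roots of det F in (x₀, x_N), counted with multiplicity}`,
and the same with the positive index (`card_roots_ge_sum_dist_posIndex`); for `x₀ ≥ 0` the right-hand side is at most the
number of positive roots with multiplicity (`card_posRoots_multiset_ge_sum_dist_negIndex`).  PROOF: per gap, the two-sided
window inequality `Inertia.negIndex_dist_le_sum_corank` and `corank ≤ mult` (`Inertia.sum_corank_le_card_roots_filter`); the
gaps are disjoint. [folklore]; axioms standard; no definitions.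
-/

-- layout Summits/ValiantsHypothesis/ValiantsHypothesis forces the duplicated namespace component
set_option linter.dupNamespace false

namespace Summit.ValiantsHypothesis.ValiantsHypothesis.Theorems.LacunarySymmetroidMatrixDescartes

open Polynomial Matrix Finset
open scoped BigOperators Topology

namespace Inertia

variable {ι : Type} [Fintype ι] [DecidableEq ι]

/-! ## §1 Disjoint gaps of a chain of scales -/

omit [Fintype ι] [DecidableEq ι] in
/-- **Disjoint gaps**: for scales `x₀ < ⋯ < x_N`, the elements of a multiset lying in the open gaps `(xᵢ, xᵢ₊₁)` number (with
multiplicity, summed over the gaps) at most those lying in `(x₀, x_N)`. [folklore] -/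
theorem sum_card_filter_gap_le (M : Multiset ℝ) {N : ℕ} (x : Fin (N + 1) → ℝ) (hx : StrictMono x) :
    ∑ i : Fin N, Multiset.card (M.filter (fun t => x i.castSucc < t ∧ t < x i.succ))
      ≤ Multiset.card (M.filter (fun t => x 0 < t ∧ t < x (Fin.last N))) := by
  classical
  have hdisj : ((Finset.univ : Finset (Fin N)) : Set (Fin N)).PairwiseDisjoint
      (fun i : Fin N => M.toFinset.filter (fun t => x i.castSucc < t ∧ t < x i.succ)) := by
    intro i _ i' _ hne
    rw [Function.onFun, Finset.disjoint_left]
    intro t ht ht'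
    obtain ⟨-, h1, h2⟩ := Finset.mem_filter.1 ht
    obtain ⟨-, h3, h4⟩ := Finset.mem_filter.1 ht'
    exact hne (DefiniteMoments.gap_eq_of_mem x hx i i' t h1 h2 h3 h4)
  have hsub : (Finset.univ : Finset (Fin N)).biUnion
      (fun i => M.toFinset.filter (fun t => x i.castSucc < t ∧ t < x i.succ))
        ⊆ M.toFinset.filter (fun t => x 0 < t ∧ t < x (Fin.last N)) := by
    intro t ht
    obtain ⟨i, -, hi⟩ := Finset.mem_biUnion.1 ht
    obtain ⟨htM, h1, h2⟩ := Finset.mem_filter.1 hi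
    refine Finset.mem_filter.2 ⟨htM, lt_of_le_of_lt (hx.monotone (Fin.zero_le _)) h1,
      lt_of_lt_of_le h2 (hx.monotone (Fin.le_last _))⟩
  calc ∑ i : Fin N, Multiset.card (M.filter (fun t => x i.castSucc < t ∧ t < x i.succ))
      = ∑ i : Fin N, ∑ t ∈ M.toFinset.filter (fun t => x i.castSucc < t ∧ t < x i.succ), M.count t :=
        Finset.sum_congr rfl fun i _ => DefiniteMoments.card_filter_eq_sum_count M _
    _ = ∑ t ∈ (Finset.univ : Finset (Fin N)).biUnion
          (fun i => M.toFinset.filter (fun t => x i.castSucc < t ∧ t < x i.succ)), M.count t :=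
        (Finset.sum_biUnion hdisj).symm
    _ ≤ ∑ t ∈ M.toFinset.filter (fun t => x 0 < t ∧ t < x (Fin.last N)), M.count t :=
        Finset.sum_le_sum_of_subset_of_nonneg hsub fun _ _ _ => Nat.zero_le _
    _ = Multiset.card (M.filter (fun t => x 0 < t ∧ t < x (Fin.last N))) := (DefiniteMoments.card_filter_eq_sum_count M _).symm

/-! ## §2 The inertia-walk certificate -/

section Pencil

variable {κ : Type} [Fintype κ]

/-- **One gap.**  Between two non-singular scales `a ≤ b` the negative index moves by at most the number of roots of
`det F` in `(a, b)` counted with multiplicity. [folklore] -/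
theorem dist_negIndex_le_card_roots_gap (d : κ → ℕ) (S : κ → Matrix ι ι ℝ) (hS : ∀ k, (S k).IsSymm)
    (hdet : Matrix.det (∑ k, ((X : ℝ[X]) ^ d k) • (S k).map C) ≠ 0) {a b : ℝ} (hab : a ≤ b)
    (ha : (∑ k, a ^ d k • S k).det ≠ 0) (hb : (∑ k, b ^ d k • S k).det ≠ 0) :
    Nat.dist (Fintype.card {j // (isHermitian_pencil d S hS b).eigenvalues j < 0})
        (Fintype.card {j // (isHermitian_pencil d S hS a).eigenvalues j < 0})
      ≤ Multiset.card ((Matrix.det (∑ k, ((X : ℝ[X]) ^ d k) • (S k).map C)).roots.filter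
          (fun t => a < t ∧ t < b)) := by
  classical
  have h := negIndex_dist_le_sum_corank (fun x => ∑ k, x ^ d k • S k) (continuous_pencil_entry d S)
    (isHermitian_pencil d S hS) (Matrix.det (∑ k, ((X : ℝ[X]) ^ d k) • (S k).map C)).roots.toFinset hab
    (fun x _ hx => mem_rootSet_of_det_eq_zero d S hdet hx) ha hb
  have hm := sum_corank_le_card_roots_filter d S hdet (fun t => a < t ∧ t < b)
  beta_reduce at h
  unfold Nat.dist
  omega

/-- Positive-index form of the one-gap bound. [folklore] -/
theorem dist_posIndex_le_card_roots_gap (d : κ → ℕ) (S : κ → Matrix ι ι ℝ) (hS : ∀ k, (S k).IsSymm)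
    (hdet : Matrix.det (∑ k, ((X : ℝ[X]) ^ d k) • (S k).map C) ≠ 0) {a b : ℝ} (hab : a ≤ b)
    (ha : (∑ k, a ^ d k • S k).det ≠ 0) (hb : (∑ k, b ^ d k • S k).det ≠ 0) :
    Nat.dist (Fintype.card {j // 0 < (isHermitian_pencil d S hS b).eigenvalues j})
        (Fintype.card {j // 0 < (isHermitian_pencil d S hS a).eigenvalues j})
      ≤ Multiset.card ((Matrix.det (∑ k, ((X : ℝ[X]) ^ d k) • (S k).map C)).roots.filter
          (fun t => a < t ∧ t < b)) := by
  have h := dist_negIndex_le_card_roots_gap d S hS hdet hab ha hb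
  have ca := negIndex_add_posIndex_add_corank (isHermitian_pencil d S hS a)
  have cb := negIndex_add_posIndex_add_corank (isHermitian_pencil d S hS b)
  rw [corank_eq_zero_of_det_ne_zero ha] at ca
  rw [corank_eq_zero_of_det_ne_zero hb] at cb
  unfold Nat.dist at h ⊢
  omega

/-- **THE INERTIA-WALK CERTIFICATE.**  `F(X) = ∑ₖ X^{dₖ} Sₖ` with real symmetric letters and `det F ≢ 0`; test scales
`x₀ < x₁ < ⋯ < x_N` at which `F` is non-singular.  Then the total variation of the negative index along the chain is a lower
bound for the number of roots of `det F` in `(x₀, x_N)` COUNTED WITH MULTIPLICITY: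
`∑_{i<N} |ν(F(xᵢ₊₁)) − ν(F(xᵢ))| ≤ #{roots in (x₀, x_N), with multiplicity}`. [folklore] -/
theorem card_roots_ge_sum_dist_negIndex (d : κ → ℕ) (S : κ → Matrix ι ι ℝ) (hS : ∀ k, (S k).IsSymm)
    (hdet : Matrix.det (∑ k, ((X : ℝ[X]) ^ d k) • (S k).map C) ≠ 0) {N : ℕ} (x : Fin (N + 1) → ℝ)
    (hx : StrictMono x) (hns : ∀ i, (∑ k, x i ^ d k • S k).det ≠ 0) :
    ∑ i : Fin N, Nat.dist (Fintype.card {j // (isHermitian_pencil d S hS (x i.succ)).eigenvalues j < 0})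
        (Fintype.card {j // (isHermitian_pencil d S hS (x i.castSucc)).eigenvalues j < 0})
      ≤ Multiset.card ((Matrix.det (∑ k, ((X : ℝ[X]) ^ d k) • (S k).map C)).roots.filter
          (fun t => x 0 < t ∧ t < x (Fin.last N))) := by
  refine le_trans (Finset.sum_le_sum fun i _ =>
    dist_negIndex_le_card_roots_gap d S hS hdet (hx (Fin.castSucc_lt_succ)).le (hns _) (hns _)) ?_
  exact sum_card_filter_gap_le _ x hx

/-- **Positive-index form of the certificate.** [folklore] -/
theorem card_roots_ge_sum_dist_posIndex (d : κ → ℕ) (S : κ → Matrix ι ι ℝ) (hS : ∀ k, (S k).IsSymm)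
    (hdet : Matrix.det (∑ k, ((X : ℝ[X]) ^ d k) • (S k).map C) ≠ 0) {N : ℕ} (x : Fin (N + 1) → ℝ)
    (hx : StrictMono x) (hns : ∀ i, (∑ k, x i ^ d k • S k).det ≠ 0) :
    ∑ i : Fin N, Nat.dist (Fintype.card {j // 0 < (isHermitian_pencil d S hS (x i.succ)).eigenvalues j})
        (Fintype.card {j // 0 < (isHermitian_pencil d S hS (x i.castSucc)).eigenvalues j})
      ≤ Multiset.card ((Matrix.det (∑ k, ((X : ℝ[X]) ^ d k) • (S k).map C)).roots.filter
          (fun t => x 0 < t ∧ t < x (Fin.last N))) := by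
  refine le_trans (Finset.sum_le_sum fun i _ =>
    dist_posIndex_le_card_roots_gap d S hS hdet (hx (Fin.castSucc_lt_succ)).le (hns _) (hns _)) ?_
  exact sum_card_filter_gap_le _ x hx

/-- **Positive roots with multiplicity, certified from below by an inertia walk on positive scales.** [folklore] -/
theorem card_posRoots_multiset_ge_sum_dist_negIndex (d : κ → ℕ) (S : κ → Matrix ι ι ℝ) (hS : ∀ k, (S k).IsSymm)
    (hdet : Matrix.det (∑ k, ((X : ℝ[X]) ^ d k) • (S k).map C) ≠ 0) {N : ℕ} (x : Fin (N + 1) → ℝ)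
    (hx : StrictMono x) (hx0 : 0 ≤ x 0) (hns : ∀ i, (∑ k, x i ^ d k • S k).det ≠ 0) :
    ∑ i : Fin N, Nat.dist (Fintype.card {j // (isHermitian_pencil d S hS (x i.succ)).eigenvalues j < 0})
        (Fintype.card {j // (isHermitian_pencil d S hS (x i.castSucc)).eigenvalues j < 0})
      ≤ Multiset.card ((Matrix.det (∑ k, ((X : ℝ[X]) ^ d k) • (S k).map C)).roots.filter (fun t => 0 < t)) := by
  refine le_trans (card_roots_ge_sum_dist_negIndex d S hS hdet x hx hns) ?_
  refine Multiset.card_le_card (Multiset.monotone_filter_right _ fun t ht => ?_)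
  exact lt_of_le_of_lt hx0 ht.1

/-- **Distinct-root form (weaker but in the census currency)**: the number of DISTINCT roots of `det F` in `(x₀, x_N)` is at
least the number of gaps across which the negative index CHANGES. [folklore] -/
theorem card_rootSet_ge_card_jumps (d : κ → ℕ) (S : κ → Matrix ι ι ℝ) (hS : ∀ k, (S k).IsSymm)
    (hdet : Matrix.det (∑ k, ((X : ℝ[X]) ^ d k) • (S k).map C) ≠ 0) {N : ℕ} (x : Fin (N + 1) → ℝ)
    (hx : StrictMono x) (hns : ∀ i, (∑ k, x i ^ d k • S k).det ≠ 0) :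
    (Finset.univ.filter fun i : Fin N =>
        Fintype.card {j // (isHermitian_pencil d S hS (x i.succ)).eigenvalues j < 0}
          ≠ Fintype.card {j // (isHermitian_pencil d S hS (x i.castSucc)).eigenvalues j < 0}).card
      ≤ ((Matrix.det (∑ k, ((X : ℝ[X]) ^ d k) • (S k).map C)).roots.toFinset.filter
          (fun t => x 0 < t ∧ t < x (Fin.last N))).card := by
  classical
  set P := Matrix.det (∑ k, ((X : ℝ[X]) ^ d k) • (S k).map C) with hP
  -- each jumping gap contains a root
  have hgap : ∀ i : Fin N,
      Fintype.card {j // (isHermitian_pencil d S hS (x i.succ)).eigenvalues j < 0}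
        ≠ Fintype.card {j // (isHermitian_pencil d S hS (x i.castSucc)).eigenvalues j < 0} →
      ∃ t ∈ P.roots.toFinset, x i.castSucc < t ∧ t < x i.succ := by
    intro i hne
    have h := dist_negIndex_le_card_roots_gap d S hS hdet (hx (Fin.castSucc_lt_succ)).le (hns i.castSucc) (hns i.succ)
    have hpos : 0 < Multiset.card (P.roots.filter (fun t => x i.castSucc < t ∧ t < x i.succ)) := by
      refine lt_of_lt_of_le ?_ h
      unfold Nat.dist
      omega
    obtain ⟨t, ht⟩ := Multiset.card_pos_iff_exists_mem.1 hpos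
    rw [Multiset.mem_filter] at ht
    exact ⟨t, Multiset.mem_toFinset.2 ht.1, ht.2⟩
  choose! f hf using hgap
  -- `f` is injective on the jumping gaps (disjoint gaps) and lands in the root set of the big window
  calc (Finset.univ.filter fun i : Fin N =>
          Fintype.card {j // (isHermitian_pencil d S hS (x i.succ)).eigenvalues j < 0}
            ≠ Fintype.card {j // (isHermitian_pencil d S hS (x i.castSucc)).eigenvalues j < 0}).card
      = ((Finset.univ.filter fun i : Fin N =>
          Fintype.card {j // (isHermitian_pencil d S hS (x i.succ)).eigenvalues j < 0}
            ≠ Fintype.card {j // (isHermitian_pencil d S hS (x i.castSucc)).eigenvalues j < 0}).image f).card := by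
        refine (Finset.card_image_of_injOn fun i hi i' hi' hff => ?_).symm
        have h1 := (hf i (Finset.mem_filter.1 (Finset.mem_coe.1 hi)).2).2
        have h2 := (hf i' (Finset.mem_filter.1 (Finset.mem_coe.1 hi')).2).2
        rw [hff] at h1
        exact DefiniteMoments.gap_eq_of_mem x hx i i' (f i') h1.1 h1.2 h2.1 h2.2
    _ ≤ (P.roots.toFinset.filter (fun t => x 0 < t ∧ t < x (Fin.last N))).card := by
        refine Finset.card_le_card fun t ht => ?_
        obtain ⟨i, hi, rfl⟩ := Finset.mem_image.1 ht
        obtain ⟨hmem, h1, h2⟩ := hf i (Finset.mem_filter.1 hi).2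
        exact Finset.mem_filter.2 ⟨hmem, lt_of_le_of_lt (hx.monotone (Fin.zero_le _)) h1,
          lt_of_lt_of_le h2 (hx.monotone (Fin.le_last _))⟩

end Pencil

end Inertia

end Summit.ValiantsHypothesis.ValiantsHypothesis.Theorems.LacunarySymmetroidMatrixDescartes
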